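import Summits.QuantumFields.BalabanUV.T4Continuum.Spine.NE1p.DressedRootStrict
import Summits.QuantumFields.BalabanUV.T4Continuum.Spine.NE1p.DressedUniformConstantsOf

/-!
# T⁴ programme, spine estimate NE1′ (node O3b/H2) — THE COMPOSITION-ROUTE FACE: ROOT-C OF RECORD with the transport leaf T
# supplied by the lineage's DETERMINISTIC END `transportsFromVar_of_response` (no density-layer binder: no `wOp`, no
# `RealBaseAt`, no `ExponentSliceAt`, no action margin)

Cell `pub-balaban`, sub-cell `t4`, BINDER-OWNERS row NE1′; owner lineage t4-ne1p-p1 (PROVER seat P1, «RG-trajectory comparison»),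
generation 24; the kernel form of OPTION F-2-ROUTE-FULL of the owner memo `HOME/b2b-balaban-t4-ne1p-p1/g24/OWNER-ANSWERS-g24.md` v1.1
§2bis (R7) ∕ §3 (question Q-NE1p-route to the dagwriter).  ADDITIVE — imports `Spine/NE1p/DressedRootStrict` (ROOT-C of record,
p216910) and `Spine/NE1p/DressedUniformConstantsOf` (row S3-sup: `uniformConstantsOf` ∕ `bookingLeavesOf` for a general K-free step
factor `a`, p213131) ONLY; THEOREMS ONLY (no `def`, no `def … : Prop`).

WHY THIS FILE.  Every crew END-ALL face reaches the root through END-F `DressedRoot.transportLeaf_of_centredExponent`, whose step law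
`hFn = wOp (expWeight base (𝒜+𝒬)) …` with `hB : RealBaseAt`, `hE : ExponentSliceAt … (s b k)`, `hs₀ : s ≤ s̄⁰ < 1` models the
NORMALISED met operation — [Balaban1989LargeFieldII]'s ALTERNATIVE representation (1.103)–(1.104) p. 391 ((1.75)'s `e^{3sup|σ|}`),
which is where the wall item (w2-act) «THE NUMBER» lives.  The owner's located read (memo §1–§2bis) is that on print's PRIMARY
routes — the polymer expansions [Balaban1989LargeFieldII] (1.72)→(1.90)–(1.98) at met components (σ consumed only as the additive
«+1» of (1.92), paid by the displayed clause p. 389) and [Balaban1988RGII] (2.8)–(2.15), Lemma 3 (2.38), (2.41) at small-field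
steps (activities with UPPER bounds, a Gaussian normaliser only, analyticity margins `(1+β)α` displayed p. 15) — NO
exponent-oscillation margin is consumed at any step (LOCI only; nothing of the audited manuscripts is cited as a fact).  Under the
corresponding dictionary (observable-attached terms = the μ-parts of print's polymer outputs; births-only trajectories) the
transport leaf T of END-B is NOT the density layer's but the lineage's DETERMINISTIC END
`T4TrajectoryComparison.transportsFromVar_of_response` (p189630; engine `T4BirthChartTransport.transport_of_birthChart`), whose
binders re-read: `hsl` — the carried function of generation `(b,k′)` AT SCALE `k` (the birth function composed with the value maps)
still has a `BirthSlice` of the common radius `r` and window `w` with sup `(∏ α)·gen` — ⇐ containment WITH MARGIN of the value map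
(the owner's NAMED OPEN ESTIMATE R6 (VAL-θ)-lite; printed TYPE [Balaban1989LargeFieldII] (1.65) p. 375, [Balaban1988RGII] p. 15,
[Balaban1988Convergent] (2.34)–(2.39) p. 261; asserted for Bałaban's maps NOWHERE); `hrate` — the transverse defect rate `c_δ·ψ^{k−k′}`
(leaf F-6) — ⇐ the value map's felt-size contraction `θ_{k→k+1} ≍ L⁻²` per step ((VAL-θ), printed TYPE [Balaban1987RGI] p. 307;
road P4 `CovariantMeanLatticeDepth.depthRatio`); `hinv`, `hmove`, `hdefw`, `hlin` structural ∕ attainment.  This file wires it: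

* §1 `transportLeaf_of_composition` — `BookingLeaves.htr`'s field TYPE at `C = 4c_δ/r`, `ρ i = ψ·α i`, gate = the dressed budget gate,
  from the deterministic END BY NAME; NO `wOp`, NO `RealBaseAt`∕`ExponentSliceAt`, NO `hP`, NO `hdom`, NO action margin among its
  binders — the (w2-act) binders of END-F do not occur.
* §2 `dressedStabilityStrict_of_composition` — ROOT-C OF RECORD `DressedStabilityStrict 𝒯 (L^4)` from ONE K-∕μ-free number set
  (`uniformConstantsOf L a (4c_δ/r) c̄ …`, step factor `a` = the continuation factor of the composed sups; the composition reading
  is `a = 1`) and, at every `(p, K)`: the deterministic function-level data of §1 at the CONSTANT profile `α ≡ a`, the births leaf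
  (w1)+(w5b) `hbirth`, the regeneration leaf (w5) `hreg`, counts (w3-book), margins `hs₀` (free to be `0` on this route) —
  `bookingLeavesOf` + `dressedStabilityStrict_of_bookingLeaves` BY NAME; headline `dressedStability_of_composition`; ROOT-B
  `dressedBudget_of_composition` (`dressedBudget_of_dressedStabilityStrict` BY NAME, positional counts displayed).
* §3 THE CELL WITHOUT `e³`: at `a = 1` the located largeness is `locOf L 1 C c̄ = 1/L + L·C·c̄` — `1 < L` is what (w7) forces
  (`one_lt_of_composition_cell`, from row S3c's `necessity_of_stepFactor` pattern re-proved here in two lines) and `L = 2` with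
  `C·c̄ ≤ 1/8` already gives `locOf ≤ 3/4` (`locOf_two_one_le`) — the record's «L > e³(1+…) ≈ 20.1» (R2; S3c: `21 ≤ L`) was (1.75)'s
  `e³` and is absent on this route.  Decided arithmetic of the cell's shapes, NOT a statement about Bałaban's `L`.

HONEST FRAMING.  A face over hypothesis SHAPES: the deterministic binders `hsl`∕`hrate` at later scales are exactly where the ONE new
estimate (VAL-θ) enters (containment-with-margin and felt-size contraction of the value map) — DISPLAYED, never discharged; (w1) `hbirth`,
(w5) `hreg`, (w3-book) counts displayed as before; whether the dressed run may be booked on the polymer route at every step is the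
owner's READING and the dagwriter's question Q-NE1p-route, not a theorem.  Nothing of Bałaban's densities is instantiated; 0 sorry;
no `def`; headline «ROOT-C ⇐ the named deterministic binders + (w1) + (w5) + counts», never «NE1′ proved».  NE1′ NOT printed, NOT
proved; spine PROVED 0∕9.  Rung (B)+1 on ONE finite four-torus — NOT infinite volume, NOT a mass gap, NOT OS on ℝ⁴, NOT Clay.
HONEST DEPENDENCY: continuum YM on T⁴ ⇐ BetaPertH ∧ nine spine estimates (0/9 proved); BetaPertH ⇐ (D1) ∧ (D4) ∧ CAP+tail; G-an2-4
gates asym, D1 and NE2/3/4.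
-/

noncomputable section

namespace Summit.QuantumFields.BalabanUV.T4Continuum.NE1p.DressedRootComposition

open Finset
open scoped BigOperators
open Literature.MathematicalPhysics.QuantumFieldTheory.Balaban1983to89
open Literature.MathematicalPhysics.QuantumFieldTheory.Balaban1983to89.T4TermFormat
open Literature.MathematicalPhysics.QuantumFieldTheory.Balaban1983to89.T4TrajectoryComparison
open Literature.MathematicalPhysics.QuantumFieldTheory.Balaban1983to89.T4BirthChartTransport
  (GaugeInvariant BirthSlice RelGauge)
open Summit.QuantumFields.BalabanUV.T4Continuum.T4TrajectoryDensityDressed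
open Summit.QuantumFields.BalabanUV.T4Continuum.NE1p.DressedRoot
open Summit.QuantumFields.BalabanUV.T4Continuum.NE1p.DressedUniformConstants

/-! ## §1 The transport leaf from the deterministic END -/

section TransportLeaf

variable {B : T4TermFormat.Booking} {T : Trajectory B}
variable {𝒰 Dir F : Type*} [NormedAddCommGroup F] [NormedSpace ℂ F] [CompleteSpace F]
  {move : 𝒰 → Dir → ℂ → 𝒰} {N : Dir → ℝ} {w r : ℝ}

/-- **THE COMPOSITION-ROUTE TRANSPORT LEAF** [bookkeeping]: `BookingLeaves.htr`'s field type — `TransportsFromVar (4c_δ/r) (ψ·α)`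
gated by the dressed budget gate — from the lineage's DETERMINISTIC END `transportsFromVar_of_response` BY NAME.  Displayed: per
generation `(b,k′)` and scale `k`, the carried (composed) function `Fn b k′ k` is invariant under the generation's relation (`hinv`)
and, under the history, keeps a `BirthSlice` along `move` of the common radius `r`, window `w`, regular set `𝒦 b k′` with sup
`(∏_{[k′,k)} α)·gen b k′` (`hsl` — at later scales this is containment-with-margin of the value map, (VAL-θ)-lite, NOT asserted);
the fresh-pair defect is `≤ w` and `≤ c_δ·ψ^{k−k′}` (`hdefw`, `hrate` — leaf F-6 = the value map's felt-size contraction, NOT asserted);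
the booked size is attained (`hlin`).  NO `wOp`, NO `RealBaseAt`∕`ExponentSliceAt`, NO action margin. [folklore] -/
theorem transportLeaf_of_composition {Fn : B.Birth → ℕ → ℕ → 𝒰 → F} {rel : B.Birth → ℕ → 𝒰 → 𝒰 → Prop}
    {𝒦 : B.Birth → ℕ → Set 𝒰} {defect : B.Birth → ℕ → ℕ → ℝ} {cδ ψ m : ℝ} {α : ℕ → ℝ}
    {s : B.Birth → ℕ → ℝ} {S : ℕ → B.Birth → Finset B.Birth}
    (hα : ∀ i, 0 ≤ α i) (hinv : ∀ b k' k, GaugeInvariant (rel b k') (Fn b k' k))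
    (hsl : ∀ (b : B.Birth) (k' k : ℕ), B.birthScale b ≤ k' → k' ≤ k → k ≤ B.K →
      RanBelow (budgetGate T s m S (4 * cδ / r) (fun i => ψ * α i)) k →
      BirthSlice (Fn b k' k) move N (𝒦 b k') w r (stepProd α k' k * T.gen b k'))
    (hmove : ∀ U d, move U d 0 = U) (hr : 0 < r) (hdefw : ∀ b k' k, defect b k' k ≤ w)
    (hrate : ∀ (b : B.Birth) (k' k : ℕ), B.birthScale b ≤ k' → k' ≤ k → k ≤ B.K →
      defect b k' k ≤ cδ * ψ ^ (k - k'))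
    (hlin : ∀ (b : B.Birth) (k' k : ℕ), B.birthScale b ≤ k' → k' ≤ k → k ≤ B.K →
      RanBelow (budgetGate T s m S (4 * cδ / r) (fun i => ψ * α i)) k → ∀ ε > 0,
      ∃ U₀ ∈ 𝒦 b k', ∃ U₁ : 𝒰, RelGauge (rel b k') move N U₀ U₁ (defect b k' k) ∧
        T.lin b k' k ≤ ‖Fn b k' k U₁ - Fn b k' k U₀‖ + ε) :
    T.TransportsFromVar (4 * cδ / r) (fun i => ψ * α i) (budgetGate T s m S (4 * cδ / r) (fun i => ψ * α i)) :=
  transportsFromVar_of_response (Gate := budgetGate T s m S (4 * cδ / r) (fun i => ψ * α i))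
    hα hinv hsl hmove hr hdefw hrate hlin

/-- **CONSTANT CONTINUATION FACTOR** [bookkeeping]: at the profile `α ≡ a` the leaf has the constant rate `ψ·a` — the shape
`bookingLeavesOf` consumes at `ψ = L⁻²` (the composition reading is `a = 1`: sups do not grow under composition; NOT asserted for
Bałaban's maps). [folklore] -/
theorem transportLeaf_of_composition_const {Fn : B.Birth → ℕ → ℕ → 𝒰 → F} {rel : B.Birth → ℕ → 𝒰 → 𝒰 → Prop}
    {𝒦 : B.Birth → ℕ → Set 𝒰} {defect : B.Birth → ℕ → ℕ → ℝ} {cδ ψ m a : ℝ}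
    {s : B.Birth → ℕ → ℝ} {S : ℕ → B.Birth → Finset B.Birth}
    (ha : 0 ≤ a) (hinv : ∀ b k' k, GaugeInvariant (rel b k') (Fn b k' k))
    (hsl : ∀ (b : B.Birth) (k' k : ℕ), B.birthScale b ≤ k' → k' ≤ k → k ≤ B.K →
      RanBelow (budgetGate T s m S (4 * cδ / r) (fun _ : ℕ => ψ * a)) k →
      BirthSlice (Fn b k' k) move N (𝒦 b k') w r (a ^ (k - k') * T.gen b k'))
    (hmove : ∀ U d, move U d 0 = U) (hr : 0 < r) (hdefw : ∀ b k' k, defect b k' k ≤ w)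
    (hrate : ∀ (b : B.Birth) (k' k : ℕ), B.birthScale b ≤ k' → k' ≤ k → k ≤ B.K →
      defect b k' k ≤ cδ * ψ ^ (k - k'))
    (hlin : ∀ (b : B.Birth) (k' k : ℕ), B.birthScale b ≤ k' → k' ≤ k → k ≤ B.K →
      RanBelow (budgetGate T s m S (4 * cδ / r) (fun _ : ℕ => ψ * a)) k → ∀ ε > 0,
      ∃ U₀ ∈ 𝒦 b k', ∃ U₁ : 𝒰, RelGauge (rel b k') move N U₀ U₁ (defect b k' k) ∧
        T.lin b k' k ≤ ‖Fn b k' k U₁ - Fn b k' k U₀‖ + ε) :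
    T.TransportsFromVar (4 * cδ / r) (fun _ : ℕ => ψ * a) (budgetGate T s m S (4 * cδ / r) (fun _ : ℕ => ψ * a)) := by
  have hsl' : ∀ (b : B.Birth) (k' k : ℕ), B.birthScale b ≤ k' → k' ≤ k → k ≤ B.K →
      RanBelow (budgetGate T s m S (4 * cδ / r) (fun i => ψ * (fun _ : ℕ => a) i)) k →
      BirthSlice (Fn b k' k) move N (𝒦 b k') w r (stepProd (fun _ : ℕ => a) k' k * T.gen b k') := by
    intro b k' k hb hk' hk hran
    rw [stepProd_const]
    exact hsl b k' k hb hk' hk hran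
  exact transportLeaf_of_composition (α := fun _ : ℕ => a) (fun _ => ha) hinv hsl' hmove hr hdefw hrate hlin

end TransportLeaf

/-! ## §2 ROOT-C of record on the composition route -/

section Root

variable {P : Type*} (𝒯 : DressedTower P)
variable {𝒰 Dir F : Type*} [NormedAddCommGroup F] [NormedSpace ℂ F] [CompleteSpace F]
  {move : 𝒰 → Dir → ℂ → 𝒰} {N : Dir → ℝ} {w r : ℝ}

/-- **ROOT-C OF RECORD ON THE COMPOSITION ROUTE** [bookkeeping]: ONE K-∕μ-free number set — block size `L ≥ 1`, continuation
factor `a ≥ 0`, birth-chart data `c_δ ≥ 0`, `r > 0`, regeneration bound `c̄`, multiplicity `N₀`, amplitude `A₀`, source factor `m`,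
margin bound `s̄⁰`, located largeness `locOf L a (4c_δ/r) c̄ ≤ ρ′ < 1` ((w7)), window (w6) — and, at EVERY run parameter and cutoff, the
DETERMINISTIC transport data of §1 at the constant profile `α ≡ a` (rate `L⁻²·a`), the births leaf (w1)+(w5b) `hbirth`, the
regeneration leaf (w5) `hreg` with `0 ≤ c ≤ c̄`, the counts (w3-book) at rate `L⁴`, margins `s₀ ≤ s̄⁰` (on this route `s₀` may be taken
`≡ 0`) ⟹ `DressedStabilityStrict 𝒯 (L^4)`.  `bookingLeavesOf` + `dressedStabilityStrict_of_bookingLeaves` BY NAME.  NO density-layer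
binder occurs.  «ROOT-C ⇐ the named binders», NOT «NE1′ proved». [folklore] -/
theorem dressedStabilityStrict_of_composition {L a cδ cbar N₀ A₀ m sbar ρ' : ℝ} (hL : 1 ≤ L) (ha : 0 ≤ a) (hcδ : 0 ≤ cδ)
    (hr : 0 < r) (hcbar : 0 ≤ cbar) (hN₀ : 0 ≤ N₀) (hA₀ : 0 ≤ A₀) (hm : 0 ≤ m)
    (hloc : locOf L a (4 * cδ / r) cbar ≤ ρ') (hρ'1 : ρ' < 1) (hsmall : m * (N₀ * A₀ * (1 - ρ')⁻¹) ≤ 1 - sbar)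
    (c : P → ℕ → ℕ → ℝ) (s₀ : ∀ p K, (𝒯.B p K).Birth → ℕ → ℝ)
    (S : ∀ p K, ℕ → (𝒯.B p K).Birth → Finset (𝒯.B p K).Birth)
    (hc0 : ∀ p K k, 0 ≤ c p K k) (hcb : ∀ p K k, k < (𝒯.B p K).K → c p K k ≤ cbar)
    (hS : ∀ p K k b, ∀ f ∈ S p K k b, (𝒯.B p K).birthScale f ≤ k)
    (hcount : ∀ p K k b, ∀ j ≤ k,
      ((((S p K k b).filter fun f => (𝒯.B p K).birthScale f = j).card : ℝ)) ≤ N₀ * (L ^ 4) ^ (k - j))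
    (hs₀ : ∀ p K b k, s₀ p K b k ≤ sbar)
    (hbirth : ∀ p K, (𝒯.T p K).BirthsFromOld (4 * cδ / r) (fun _ : ℕ => (L ^ 2)⁻¹ * a)
      (twoRate A₀ (rhoOneOf (L ^ 2)⁻¹ a (4 * cδ / r) cbar) (L⁻¹ ^ 3) (𝒯.B p K).K)
      (budgetGate (𝒯.T p K) (s₀ p K) m (S p K) (4 * cδ / r) (fun _ : ℕ => (L ^ 2)⁻¹ * a)))
    (hreg : ∀ p K, (𝒯.T p K).RegeneratesFromVar (c p K)
      (budgetGate (𝒯.T p K) (s₀ p K) m (S p K) (4 * cδ / r) (fun _ : ℕ => (L ^ 2)⁻¹ * a)))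
    -- the deterministic function-level transport data, per run parameter and cutoff
    (Fn : ∀ p K, (𝒯.B p K).Birth → ℕ → ℕ → 𝒰 → F) (rel : ∀ p K, (𝒯.B p K).Birth → ℕ → 𝒰 → 𝒰 → Prop)
    (𝒦 : ∀ p K, (𝒯.B p K).Birth → ℕ → Set 𝒰) (defect : ∀ p K, (𝒯.B p K).Birth → ℕ → ℕ → ℝ)
    (hinv : ∀ p K b k' k, GaugeInvariant (rel p K b k') (Fn p K b k' k))
    (hsl : ∀ p K (b : (𝒯.B p K).Birth) (k' k : ℕ), (𝒯.B p K).birthScale b ≤ k' → k' ≤ k → k ≤ (𝒯.B p K).K →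
      RanBelow (budgetGate (𝒯.T p K) (s₀ p K) m (S p K) (4 * cδ / r) (fun _ : ℕ => (L ^ 2)⁻¹ * a)) k →
      BirthSlice (Fn p K b k' k) move N (𝒦 p K b k') w r (a ^ (k - k') * (𝒯.T p K).gen b k'))
    (hmove : ∀ U d, move U d 0 = U) (hdefw : ∀ p K b k' k, defect p K b k' k ≤ w)
    (hrate : ∀ p K (b : (𝒯.B p K).Birth) (k' k : ℕ), (𝒯.B p K).birthScale b ≤ k' → k' ≤ k → k ≤ (𝒯.B p K).K →
      defect p K b k' k ≤ cδ * ((L ^ 2)⁻¹) ^ (k - k'))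
    (hlin : ∀ p K (b : (𝒯.B p K).Birth) (k' k : ℕ), (𝒯.B p K).birthScale b ≤ k' → k' ≤ k → k ≤ (𝒯.B p K).K →
      RanBelow (budgetGate (𝒯.T p K) (s₀ p K) m (S p K) (4 * cδ / r) (fun _ : ℕ => (L ^ 2)⁻¹ * a)) k → ∀ ε > 0,
      ∃ U₀ ∈ 𝒦 p K b k', ∃ U₁ : 𝒰, RelGauge (rel p K b k') move N U₀ U₁ (defect p K b k' k) ∧
        (𝒯.T p K).lin b k' k ≤ ‖Fn p K b k' k U₁ - Fn p K b k' k U₀‖ + ε) :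
    DressedStabilityStrict 𝒯 (L ^ 4) := by
  have hC : 0 ≤ 4 * cδ / r := by positivity
  have h := dressedStabilityStrict_of_bookingLeaves
    (uniformConstantsOf L a (4 * cδ / r) cbar N₀ A₀ m sbar ρ' hL ha hC hcbar hN₀ hA₀ hm hloc hρ'1 hsmall) 𝒯
    (fun p K => bookingLeavesOf hL ha hC hcbar hN₀ hA₀ hm hloc hρ'1 hsmall (c p K) (s₀ p K) (S p K)
      (hc0 p K) (hcb p K) (hS p K) (hcount p K) (hs₀ p K) (hbirth p K)
      (transportLeaf_of_composition_const (T := 𝒯.T p K) ha (hinv p K) (hsl p K) hmove hr (hdefw p K)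
        (hrate p K) (hlin p K))
      (hreg p K))
  simpa using h

end Root

/-! ## §3 The cell without `e³` -/

/-- **WHAT (w7) FORCES ON THE COMPOSITION ROUTE** [arith]: at continuation factor `a = 1` the located largeness
`locOf L 1 C c̄ = 1/L + L·C·c̄ ≤ ρ′ < 1` forces only `1 < L` (and `L·C·c̄ < 1`) — no `e³`. -/
theorem one_lt_of_composition_cell {L C cbar ρ' : ℝ} (hL : 0 < L) (hC : 0 ≤ C) (hcbar : 0 ≤ cbar)
    (hloc : locOf L 1 C cbar ≤ ρ') (hρ'1 : ρ' < 1) : 1 < L ∧ L * C * cbar < 1 := by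
  unfold locOf at hloc
  have hreg : 0 ≤ L * C * cbar := by positivity
  have hinv : 0 < 1 / L := by positivity
  have h1 : 1 / L < 1 := by linarith
  refine ⟨?_, by linarith⟩
  rw [div_lt_one hL] at h1
  exact h1

/-- **THE BLOCK SIZE `2` ALREADY FITS** [decided numeral of the cell's shape]: with `C·c̄ ≤ 1/8`, `locOf 2 1 C c̄ ≤ 3/4 < 1` — the
record's located largeness «L > e³(1+…) ≈ 20.1» (R2; row S3c `21 ≤ L`) was (1.75)'s `e³` and does not arise here.  A statement about
the cell's arithmetic, NOT about Bałaban's `L`. -/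
theorem locOf_two_one_le {C cbar : ℝ} (hreg : C * cbar ≤ 1 / 8) :
    locOf 2 1 C cbar ≤ 3 / 4 := by
  unfold locOf
  nlinarith [hreg]

/-- **HEADLINE ON THE COMPOSITION ROUTE** [bookkeeping]: ROOT-C (strict) ⟹ the headline `DressedStability 𝒯`
(`dressedStability_of_strict` BY NAME). [folklore] -/
theorem dressedStability_of_strict_comp {P : Type*} {𝒯 : DressedTower P} {L : ℝ}
    (h : DressedStabilityStrict 𝒯 (L ^ 4)) : DressedStability 𝒯 :=
  dressedStability_of_strict h

/-- **ROOT-B ON THE COMPOSITION ROUTE** [bookkeeping]: ROOT-C (strict) with positional counts `N₀·(L⁴)^{k−j}` and bounded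
nonnegative weights ⟹ `DressedBudget 𝒯 w` (`dressedBudget_of_dressedStabilityStrict` BY NAME). [folklore] -/
theorem dressedBudget_of_strict_comp {P : Type*} {𝒯 : DressedTower P} {L N₀ wbar : ℝ} {wt : P → ℕ → ℕ → ℝ}
    (h : DressedStabilityStrict 𝒯 (L ^ 4)) (hN₀ : 0 ≤ N₀) (hwbar : 0 ≤ wbar)
    (hw0 : ∀ p K, ∀ j ≤ K, 0 ≤ wt p K j) (hwb : ∀ p K, ∀ j ≤ K, wt p K j ≤ wbar)
    (hcount : ∀ p K, (𝒯.B p K).PositionalCount fun j k => N₀ * (L ^ 4) ^ (k - j)) :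
    DressedBudget 𝒯 wt :=
  dressedBudget_of_dressedStabilityStrict h hN₀ hwbar hw0 hwb hcount

end Summit.QuantumFields.BalabanUV.T4Continuum.NE1p.DressedRootComposition

end
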